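import Summits.Ventures.CertifiedManyBodySolver.Rows.CorrWindowCertKernelChainQuotAdjFastMaps
import HarnessLib

/-!
# The chain step on LETTER CODES (part 1): a keyed ℕ-code twin of the parity engine and of `collect`, and its transport
# lemmas through a strictly monotone letter encoding

The (L7) fast step (`Rows/CorrWindowCertKernelChainQuotAdjFast{,Maps,Box}.lean`) still handles every letter as an
`Orb (Fin N)` (a `Lex` pair of `Fin`s: one comparison ≈ 130 µs of kernel time through the `Decidable`/`Lex`/`Fin` instances),
recomputes the sort key of a monomial at every stage, and rebuilds singleton `normalizeM` calls for hint targets. This file is the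
generic half of a drop-in twin that carries every letter as its ℕ CODE `enc x` from the first touch (`Nat.blt`/`Nat.beq` ≈ 15 µs),
carries the packed key with every term, and compares monomials by their key alone:
* `insSN`, `sortSN`, `monoNFN`, `keyN`, `prependCreSN`, `insAnnSN`, `prependAnnSN`, `prependLetterPolySN`, `wordToPolySN enc`
  (normal order of an `α`-word, letters encoded on the fly), `termsToPolyKN`, `emitK`, `mergeAdjK` (merge by KEY), `collectK`;
* TRANSPORT (for any `enc` with `enc x < enc y ↔ x < y`): `insSN_map`, `sortSN_map`, `monoNFN_map_some/none1/none2`, `keyN_encM`, `wordToPolySN_eq`,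
  `beqM_encM`, `sortByKey_mapVal`, `mergeAdjK_map`, **`collectK_map : collectK (P.map (encKT enc B)) = (collect enc B P).map (encKT enc B)`**,
  **`collectK_termsToPolyKN : collectK (termsToPolyKN enc B T) = (normalizeS enc B T).map (encKT enc B)`**.
Part 2 (`Rows/CorrWindowCertKernelChainQuotAdjFastNBox.lean`) assembles the box step `stepEQN` and proves
`stepEQN r R vmax B C T H = stepEQA (boxQuot r R vmax) B C T H`.

HONEST FRAMING (xx1): Lean plumbing towards «tier P» — a PROOF-TERM-only speed-up of the kernel replay of chain steps (measured
×1.9 on a real hub step, HOME/hubbard-cov-la214-box-2/lean/g6/); every `step_s` STATEMENT, accumulator literal, census/EQUAL artefact,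
`ChainQAOK`/closer stays byte-identical. Nothing of record moves; no certificate is evaluated here; no claim node is discharged;
CONTROL/CALIBRATION context; silent on the presence of superconductivity; not a `T_c` or phase sentence; nothing about any material;
no summit statement is proved by this file. Cell `hubbard-obs` × `hubbard-downfold` (D-0154 (1)(C) La214), seat hubbard-cov-la214-box-2
g6 (`prover-hubbard-cov-la214-box-2-g6-0`), zero compute.

References: C. Jansson, D. Chaykin, C. Keil, SIAM J. Numer. Anal. 46 (2008) 180 [JanssonChaykinKeil2008]; X. Han, arXiv:2006.06002 §3
[Han2020Bootstrap]; O. Bratteli, D. W. Robinson, *Operator Algebras and Quantum Statistical Mechanics 2* §5.2.2 [BratteliRobinsonII1997].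
-/

namespace Summit.Ventures.CertifiedManyBodySolver

namespace CARPolyWindow

open Summit.Ventures.CertifiedQuantumChemistry Summit.Ventures.CertifiedQuantumChemistry.CARPoly

/-! ## §1 The code engine (computable, no order instance: letters are naturals) -/

section CodeEngine

/-- A code monomial: (creator codes, annihilator codes). [cite: BratteliRobinsonII1997, §5.2.2] -/
abbrev MonoN := List ℕ × List ℕ

/-- Signed strict insertion on codes (`none` on a repeated code). [folklore] -/
def insSN (x : ℕ) : List ℕ → Option (List ℕ × Bool)
  | [] => some ([x], false)
  | a :: A => bif Nat.blt x a then some (x :: a :: A, false) else bif Nat.beq x a then none else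
      match insSN x A with
      | none => none
      | some ls => some (a :: ls.1, !ls.2)

/-- Signed insertion sort on codes. [folklore] -/
def sortSN : List ℕ → Option (List ℕ × Bool)
  | [] => some ([], false)
  | x :: xs =>
    match sortSN xs with
    | none => none
    | some ls =>
      match insSN x ls.1 with
      | none => none
      | some ls' => some (ls'.1, xor ls.2 ls'.2)

/-- Normal form of a code monomial: sorted halves and the parity, or `none`. [cite: BratteliRobinsonII1997, §5.2.2] -/
def monoNFN (m : MonoN) : Option (MonoN × Bool) :=
  match sortSN m.1, sortSN m.2 with
  | some lc, some la => some ((lc.1, la.1), xor lc.2 la.2)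
  | _, _ => none

/-- The packed sort key on codes (same packing as `Mono.key enc B`). [folklore] -/
def keyN (B : ℕ) (m : MonoN) : ℕ :=
  m.2.foldl (fun acc v => acc * B + (v + 1)) ((m.1.foldl (fun acc v => acc * B + (v + 1)) 0) * B)

/-- `a†_x · (a†_C a_A)` on codes, with parity. [cite: BratteliRobinsonII1997, §5.2.2] -/
def prependCreSN (x : ℕ) : List ℕ → List ℕ → List (MonoN × Bool)
  | [], A => [(([x], A), false)]
  | c :: C, A =>
    bif Nat.blt x c then [((x :: c :: C, A), false)]
    else bif Nat.beq x c then []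
    else (prependCreSN x C A).map fun ms => ((c :: ms.1.1, ms.1.2), !ms.2)

/-- `a_x · (a_A)` on codes, with parity. [cite: BratteliRobinsonII1997, §5.2.2] -/
def insAnnSN (x : ℕ) : List ℕ → List (MonoN × Bool)
  | [] => [(([], [x]), false)]
  | a :: A =>
    bif Nat.blt x a then [(([], x :: a :: A), false)]
    else bif Nat.beq x a then []
    else (insAnnSN x A).map fun ms => (([], a :: ms.1.2), !ms.2)

/-- `a_x · (a†_C a_A)` on codes, with parity (one contraction term per matching creator). [cite: BratteliRobinsonII1997, §5.2.2] -/
def prependAnnSN (x : ℕ) : List ℕ → List ℕ → List (MonoN × Bool)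
  | [], A => insAnnSN x A
  | c :: C, A =>
    bif Nat.beq x c then ((C, A), false) :: (prependAnnSN x C A).map fun ms => ((c :: ms.1.1, ms.1.2), !ms.2)
    else (prependAnnSN x C A).map fun ms => ((c :: ms.1.1, ms.1.2), !ms.2)

/-- (coded letter) · (monomial, parity) list. [folklore] -/
def prependLetterPolySN (x : ℕ) (dag : Bool) (P : List (MonoN × Bool)) : List (MonoN × Bool) :=
  P.flatMap fun ms => (bif dag then prependCreSN x ms.1.1 ms.1.2 else prependAnnSN x ms.1.1 ms.1.2).map fun ms' => (ms'.1, xor ms.2 ms'.2)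

variable {α : Type*}

/-- **Normal form of an `α`-word on codes**, letters encoded on the fly by `enc`. [cite: BratteliRobinsonII1997, §5.2.2] -/
def wordToPolySN (enc : α → ℕ) : List (α × Bool) → List (MonoN × Bool)
  | [] => [(([], []), false)]
  | l :: w => prependLetterPolySN (enc l.1) l.2 (wordToPolySN enc w)

/-- A keyed code term: (key, (monomial, coefficient)). [folklore] -/
abbrev KTerm := ℕ × (MonoN × ℚ)

/-- Raw normal form of a term list as keyed code terms (one conditional negation per monomial). [folklore] -/
def termsToPolyKN (enc : α → ℕ) (B : ℕ) (T : List (List (α × Bool) × ℚ)) : List KTerm :=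
  T.flatMap fun wc => (wordToPolySN enc wc.1).map fun ms => (keyN B ms.1, (ms.1, if ms.2 then -wc.2 else wc.2))

/-- Push a keyed term unless its coefficient is zero. [folklore] -/
def emitK (t : KTerm) (rest : List KTerm) : List KTerm := if t.2.2 = 0 then rest else t :: rest

/-- Merge runs of equal-KEY adjacent keyed terms, adding coefficients, dropping zeros (the key is injective on monomials whose codes
are below `B − 1`, `key_inj`). [folklore] -/
def mergeAdjK : KTerm → List KTerm → List KTerm
  | t, [] => emitK t []
  | t, u :: rest =>
    bif Nat.beq t.1 u.1 then mergeAdjK (t.1, (t.2.1, CARPoly.qforce (t.2.2 + u.2.2))) rest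
    else emitK t (mergeAdjK u rest)

/-- `CARPoly.mergeStep` with a `Bool` test (`Nat.ble`). [folklore] -/
def mergeStepB {β : Type*} (x : ℕ × β) (kont : List (ℕ × β) → List (ℕ × β)) : List (ℕ × β) → List (ℕ × β)
  | [] => x :: kont []
  | y :: ys => bif Nat.ble x.1 y.1 then x :: kont (y :: ys) else y :: mergeStepB x kont ys

/-- `CARPoly.mergeByKey` with a `Bool` test. [folklore] -/
def mergeByKeyB {β : Type*} : List (ℕ × β) → List (ℕ × β) → List (ℕ × β)
  | [] => fun ys => ys
  | x :: xs => mergeStepB x (mergeByKeyB xs)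

/-- `CARPoly.mergePairs` with a `Bool` test. [folklore] -/
def mergePairsB {β : Type*} : List (List (ℕ × β)) → List (List (ℕ × β))
  | a :: b :: rest => mergeByKeyB a b :: mergePairsB rest
  | L => L

/-- `CARPoly.mergeAll` with a `Bool` test. [folklore] -/
def mergeAllB {β : Type*} : ℕ → List (List (ℕ × β)) → List (ℕ × β)
  | 0, L => L.flatten
  | _ + 1, [] => []
  | _ + 1, [l] => l
  | f + 1, a :: b :: rest => mergeAllB f (mergePairsB (a :: b :: rest))

/-- `CARPoly.sortByKey` with a `Bool` test (same algorithm, fewer kernel steps per comparison; `sortByKeyB_eq`). [folklore] -/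
def sortByKeyB {β : Type*} (L : List (ℕ × β)) : List (ℕ × β) := mergeAllB 64 (L.map fun x => [x])

/-- Collect keyed terms: sort by the carried key, merge, drop zeros. [folklore] -/
def collectK (P : List KTerm) : List KTerm :=
  match sortByKeyB P with
  | [] => []
  | t :: rest => mergeAdjK t rest

end CodeEngine

/-! ## §2 Transport through a strictly monotone encoding -/

section Transport

variable {α : Type*} [LinearOrder α] (enc : α → ℕ)

/-- The code monomial of a monomial. [folklore] -/
def encM (m : CARPoly.Mono α) : MonoN := (m.1.map enc, m.2.map enc)

/-- The keyed code term of a term. [folklore] -/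
def encKT (B : ℕ) (mc : CARPoly.Mono α × ℚ) : KTerm := (CARPoly.Mono.key enc B mc.1, (encM enc mc.1, mc.2))

omit [LinearOrder α] in
/-- The key on codes is the key. [folklore] -/
theorem keyN_encM (B : ℕ) (m : CARPoly.Mono α) : keyN B (encM enc m) = CARPoly.Mono.key enc B m := by
  simp only [keyN, encM, CARPoly.Mono.key, List.foldl_map]

variable (henc : ∀ x y : α, enc x < enc y ↔ x < y)
include henc

/-- A strictly monotone encoding is injective. [folklore] -/
theorem enc_inj_of_strict {x y : α} (h : enc x = enc y) : x = y := by
  rcases lt_trichotomy x y with hlt | heq | hgt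
  · exact absurd ((henc x y).2 hlt) (by omega)
  · exact heq
  · exact absurd ((henc y x).2 hgt) (by omega)

/-- `Nat.blt` on codes decides `<`. [folklore] -/
theorem blt_enc (x y : α) : Nat.blt (enc x) (enc y) = decide (x < y) := by
  rw [Bool.eq_iff_iff, Nat.blt_eq, decide_eq_true_iff]
  exact henc x y

/-- `Nat.beq` on codes decides `=`. [folklore] -/
theorem beq_enc (x y : α) : Nat.beq (enc x) (enc y) = decide (x = y) := by
  rw [Bool.eq_iff_iff, Nat.beq_eq, decide_eq_true_iff]
  exact ⟨enc_inj_of_strict enc henc, fun h => h ▸ rfl⟩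

/-- Signed insertion commutes with the encoding. [folklore] -/
theorem insSN_map (x : α) : ∀ A : List α,
    insSN (enc x) (A.map enc) = (insS x A).map fun ls => (ls.1.map enc, ls.2)
  | [] => rfl
  | a :: A => by
    rw [List.map_cons, insSN, insS, blt_enc enc henc, beq_enc enc henc]
    by_cases h1 : x < a
    · simp [h1]
    · by_cases h2 : x = a
      · simp [h2]
      · simp only [h1, h2, decide_false, cond_false, if_false, insSN_map x A]
        cases insS x A <;> rfl

/-- Signed insertion sort commutes with the encoding. [folklore] -/
theorem sortSN_map : ∀ l : List α, sortSN (l.map enc) = (sortS l).map fun ls => (ls.1.map enc, ls.2)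
  | [] => rfl
  | x :: xs => by
    rw [List.map_cons, sortSN, sortS, sortSN_map xs]
    rcases sortS xs with _ | ⟨l', s⟩
    · rfl
    · simp only [Option.map_some]
      rw [insSN_map enc henc x l']
      cases insS x l' <;> rfl

/-- The code normal form is the normal form, encoded (both halves sort). [cite: BratteliRobinsonII1997, §5.2.2] -/
theorem monoNFN_map_some {m : CARPoly.Mono α} {lc la : List α × Bool} (h1 : sortS m.1 = some lc) (h2 : sortS m.2 = some la) :
    monoNFN (encM enc m) = some (encM enc (lc.1, la.1), xor lc.2 la.2) := by
  unfold monoNFN encM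
  dsimp only
  rw [sortSN_map enc henc, sortSN_map enc henc, h1, h2]
  rfl

/-- No code normal form when the creators do not sort. [folklore] -/
theorem monoNFN_map_none1 {m : CARPoly.Mono α} (h1 : sortS m.1 = none) : monoNFN (encM enc m) = none := by
  unfold monoNFN encM
  dsimp only
  rw [sortSN_map enc henc, sortSN_map enc henc, h1]
  rfl

/-- No code normal form when the annihilators do not sort. [folklore] -/
theorem monoNFN_map_none2 {m : CARPoly.Mono α} (h2 : sortS m.2 = none) : monoNFN (encM enc m) = none := by
  unfold monoNFN encM
  dsimp only
  rw [sortSN_map enc henc, sortSN_map enc henc, h2]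
  cases sortS m.1 <;> rfl

/-- `prependCreSN` commutes with the encoding. [folklore] -/
theorem prependCreSN_map (x : α) (A : List α) : ∀ C : List α,
    prependCreSN (enc x) (C.map enc) (A.map enc) = (prependCreS x C A).map fun ms => (encM enc ms.1, ms.2)
  | [] => rfl
  | c :: C => by
    rw [List.map_cons, prependCreSN, prependCreS, blt_enc enc henc, beq_enc enc henc]
    by_cases h1 : x < c
    · simp [h1, encM]
    · by_cases h2 : x = c
      · simp [h2]
      · simp only [h1, h2, decide_false, cond_false, if_false, prependCreSN_map x A C, List.map_map]
        rfl

/-- `insAnnSN` commutes with the encoding. [folklore] -/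
theorem insAnnSN_map (x : α) : ∀ A : List α,
    insAnnSN (enc x) (A.map enc) = (insAnnS x A).map fun ms => (encM enc ms.1, ms.2)
  | [] => rfl
  | a :: A => by
    rw [List.map_cons, insAnnSN, insAnnS, blt_enc enc henc, beq_enc enc henc]
    by_cases h1 : x < a
    · simp [h1, encM]
    · by_cases h2 : x = a
      · simp [h2]
      · simp only [h1, h2, decide_false, cond_false, if_false, insAnnSN_map x A, List.map_map]
        rfl

/-- `prependAnnSN` commutes with the encoding. [folklore] -/
theorem prependAnnSN_map (x : α) (A : List α) : ∀ C : List α,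
    prependAnnSN (enc x) (C.map enc) (A.map enc) = (prependAnnS x C A).map fun ms => (encM enc ms.1, ms.2)
  | [] => by rw [List.map_nil, prependAnnSN, prependAnnS, insAnnSN_map enc henc]
  | c :: C => by
    rw [List.map_cons, prependAnnSN, prependAnnS, beq_enc enc henc, prependAnnSN_map x A C, List.map_append, List.map_map,
      List.map_map]
    by_cases h : x = c
    · simp only [h, decide_true, cond_true, if_true, List.map_cons, List.map_nil, List.singleton_append]
      rfl
    · simp only [h, decide_false, cond_false, if_false, List.map_nil, List.nil_append]
      rfl

/-- `prependLetterPolySN` commutes with the encoding. [folklore] -/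
theorem prependLetterPolySN_map (l : α × Bool) (P : List (CARPoly.Mono α × Bool)) :
    prependLetterPolySN (enc l.1) l.2 (P.map fun ms => (encM enc ms.1, ms.2)) =
      (prependLetterPolyS l P).map fun ms => (encM enc ms.1, ms.2) := by
  induction P with
  | nil => rfl
  | cons ms P ih =>
    simp only [prependLetterPolySN, prependLetterPolyS, List.map_cons, List.flatMap_cons, List.map_append] at ih ⊢
    rw [ih]
    congr 1
    rw [prependLetterS]
    cases hl : l.2
    · simp only [cond_false, Bool.false_eq_true, if_false]
      rw [show (encM enc ms.1).1 = ms.1.1.map enc from rfl, show (encM enc ms.1).2 = ms.1.2.map enc from rfl,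
        prependAnnSN_map enc henc, List.map_map, List.map_map]
      rfl
    · simp only [cond_true, if_true]
      rw [show (encM enc ms.1).1 = ms.1.1.map enc from rfl, show (encM enc ms.1).2 = ms.1.2.map enc from rfl,
        prependCreSN_map enc henc, List.map_map, List.map_map]
      rfl

/-- **The code engine IS the parity engine, encoded.** [cite: BratteliRobinsonII1997, §5.2.2] -/
theorem wordToPolySN_eq : ∀ w : List (α × Bool), wordToPolySN enc w = (wordToPolyS w).map fun ms => (encM enc ms.1, ms.2)
  | [] => rfl
  | l :: w => by rw [wordToPolySN, wordToPolyS, wordToPolySN_eq w, prependLetterPolySN_map enc henc]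

/-- The keyed raw normal form is `termsToPolyS`, encoded. [folklore] -/
theorem termsToPolyKN_eq (B : ℕ) (T : List (List (α × Bool) × ℚ)) :
    termsToPolyKN enc B T = (termsToPolyS T).map (encKT enc B) := by
  induction T with
  | nil => rfl
  | cons wc T ih =>
    simp only [termsToPolyKN, termsToPolyS, List.flatMap_cons, List.map_append] at ih ⊢
    rw [ih, wordToPolySN_eq enc henc, List.map_map, List.map_map]
    congr 1
    apply List.map_congr_left
    intro ms _
    simp only [Function.comp, encKT, keyN_encM]

end Transport

end CARPolyWindow

end Summit.Ventures.CertifiedManyBodySolver
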